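import Literature.AnabelianGeometry.EtaleTheta.Discharge.Sec5Prop52iiiRootKummerOfThetaSetting

/-!
# [EtTh] Prop. 5.2 (iii) WITH PRINT'S PIN at the §5 data OF THE §1 SETTING ⟸ exactly the root-function clause
# (the junction «θ := Θ̈», GAP-LEDGER G-L2t4-2) — Prop. 5.2 (iii) p. 324 (PDF p. 98)

Mochizuki, *The étale theta function and its Frobenioid-theoretic manifestations*, Publ. RIMS **45** (2009), Prop. 5.2 (iii)
p. 324 (PDF p. 98): «The Kummer class determined by the bi-Kummer `l·N`-th root of (ii) [cf. Proposition 4.3, (iii)] corresponds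
precisely to the reduction modulo `l·N` of the class "`η̈^Θ`" … relative to the natural isomorphism [cf. Remark 5.2.1 below] between
"`μ_{l·N}(−)`" and `Δ_Θ ⊗ (ℤ/l·Nℤ)`»; printed proof «follow immediately from the definitions»
[cite: MochizukiEtTh2009, Prop 5.2 (iii) p.324 (PDF p.98)].

abc-iut cell, layer L2, seat abc-iut-w4-d103 (gen 11), abc-iut-L2-lead row R951 «EtTh:Prop5.2(i)(ii)(iii) AFTER-BUILD COUNT CENSUS»,
cone node `EtTh:Prop5.2(iii)` (kernel id `N_EtTh_Prop5_2_iii`).  PROOF-ONLY (0 `def`, 0 instance, no named fact; nothing landed is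
edited or restated; every input is consumed BY NAME).

WHAT THE TREE HAD.  abc-iut-L2-t4's typed node `FrobenioidThetaBiKummer.ThetaPairKummerClass 𝔉 η ν` takes the §2 cocycle `η` and the
natural isomorphism `ν` as PARAMETERS.  (α) Its `η`-EXISTENTIAL form (= Prop. 4.3 (iii)) is a binder-free theorem at the genuine data
(abc-iut-f-126, `exists_thetaPairKummerClass_ofConnectedTemperoidYddData` / `…_ofThetaSettingYddData`).  (β) The PIN («corresponds
precisely to η̈^Θ mod N») is carried by abc-iut-L2-t11's `ThetaFrobenioid.ThetaSectionCompat` (FACT-LIST F-0521), which abc-iut-w4-d099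
showed EQUIVALENT to the pinned `ThetaPairKummerClass` generically over a §2 `RigidData` (`thetaPairKummerClass_of_thetaSectionCompat`,
`exists_thetaSectionCompat_of_thetaPairKummerClass`, `Discharge/Sec5ThetaSectionCompatOfKummerClass.lean`), and which abc-iut-L2-t4 showed
EQUIVALENT at the §5 data of the Setting to ONE clause on the ROOT FUNCTION alone (`thetaSectionCompat_iff_rootKummer_ofThetaSettingData`,
`Discharge/Sec5Prop52iiiRootKummerOfThetaSetting.lean`, p449695): «for every `k ∈ Π^tp_Ÿ̲̲`,
`s^⊓-gp_N(ρ k) · f_N|_{B_N} = u_{(m⁻¹(η k))⁻¹} · f_N|_{B_N}`» = the junction «`θ := Θ̈`» (GAP-LEDGER G-L2t4-2, D-row 13:37:58Z 08-26).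

WHAT IS PROVED HERE (two compositions, so that reading (β) is ONE kernel theorem with ONE displayed hypothesis):
* `ThetaFrobenioid.thetaPairKummerClass_of_thetaSectionCompat_envData` — abc-iut-w4-d099's «pin ⟸ F-0521» read over a bare §2
  `ThetaEnvData` `T` (their theorem binds a `RigidData` but uses only its underlying `ThetaEnvData`; proof verbatim after theirs, `u := 1`):
  `ThetaSectionCompat H T ι m hYdd η₁ → ThetaPairKummerClass 𝔉 η ν` for every `η` pinned to `η₁` through `m ∘ ν` (`hpin`);
* `ThetaFrobenioid.thetaPairKummerClass_ofThetaSettingData_of_rootKummer` — **Prop. 5.2 (iii) WITH THE PIN at the §5 data OF THE SETTING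
  `ofThetaSettingData μ hC hS …` (X := Π^tp_X̲̲, T := `C.thetaEnvData μ hC hS`, ιX := id) from EXACTLY the root-function clause `hroot`**
  (+ the §5 named inputs `H : Facts`, the cyclotome identification `m`, and the pin currency `hpin` relating abc-iut-L2-t4's
  `η : H_{B_N} → (l·Δ_Θ)_{B_N} ⊗ ℤ/N` to the §2 cocycle `η₁` through `m ∘ ν`): p449695 (←) then the first bullet.
So under reading (B) of this seat's census line 3/3 (02:48:33Z) the node's residual is displayed by the kernel as the single hypothesis
`hroot` = G-L2t4-2; under reading (A) nothing here is needed.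
HONEST FRAMING: kernel-checked implications between typed statements; `tf`, the roots, the constants, `η₁`, `m`, `ν` are abstract parameters
(not inhabited for the curve here); `hroot` is a NAMED OPEN junction input, not a claim; nothing of [EtTh] is asserted unconditionally; typed ≠
proved; no side is taken on anything downstream ([IUTchIII] Cor. 3.12); no abc claim.
-/

noncomputable section

namespace Literature.AnabelianGeometry.EtaleTheta

open CategoryTheory Opposite Literature.AlgebraicGeometry.Frobenioids Literature.AnabelianGeometry.SemiGraphs
  Literature.AnabelianGeometry.SemiGraphs.GaloisObjects Literature.AlgebraicGeometry.Frobenioids.QuasiTemperoid.BTempConnected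

namespace ThetaFrobenioid

/-! ### Generic: the pin ⟸ F-0521 over a bare `ThetaEnvData` -/

section Generic

universe w v v' u u'

variable {C : Type u} [Category.{v} C] {D : Type u'} [Category.{v'} D] (𝔉 : ThetaFrobenioid.{w} C D)
  (T : ThetaEnvData.{v} 𝔉.N) (H : 𝔉.Facts) (ι : 𝔉.PiX ≃* T.PiX) (m : 𝔉.muTorsion 𝔉.BN 𝔉.N ≃* T.mu)
  (hYdd : 𝔉.IdentifiesPiYdd T ι)

/-- **abc-iut-L2-t4's pinned `ThetaPairKummerClass` FROM abc-iut-L2-t11's F-0521 `ThetaSectionCompat`, over a bare §2 `ThetaEnvData`**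
(abc-iut-w4-d099's `thetaPairKummerClass_of_thetaSectionCompat` read with `T` in place of `RD.toThetaEnvData`; `u := 1`): if
`m(d(k)) = η₁(ι k)⁻¹` on `Π^tp_Ÿ̲` and `η : H_{B_N} → (l·Δ_Θ)_{B_N} ⊗ ℤ/Nℤ` is pinned to `η₁` through `m ∘ ν`, then the print-oriented
bi-Kummer difference `s^⊓-gp_N(h) · s^⊔-gp_N(h)⁻¹` is `ν(η h)` on the nose. [cite: MochizukiEtTh2009, Prop 5.2 (iii) p.324 (PDF p.98)] -/
theorem thetaPairKummerClass_of_thetaSectionCompat_envData {η₁ : T.PiYdd → T.mu}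
    (hcompat : 𝔉.ThetaSectionCompat H T ι m hYdd η₁)
    (ν : 𝔉.lDeltaModN 𝔉.BN ≃* 𝔉.muTorsion 𝔉.BN 𝔉.N) (η : 𝔉.HB → 𝔉.lDeltaModN 𝔉.BN)
    (hpin : ∀ k : 𝔉.PiYdd, m (ν (η (𝔉.rhoYdd k))) = η₁ ⟨ι k, (hYdd k).mp k.2⟩) :
    FrobenioidThetaBiKummer.ThetaPairKummerClass 𝔉 η ν := by
  refine ⟨1, one_mem _, fun h => ?_⟩
  obtain ⟨y, hy, hyh⟩ := Subgroup.mem_map.mp h.2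
  have hk : 𝔉.rhoYdd ⟨y, hy⟩ = h := Subtype.ext hyh
  -- through `m`: `d(k) = (ν η h)⁻¹`
  have hd : 𝔉.diffCocycle H ⟨y, hy⟩ = (ν (η h))⁻¹ := by
    apply m.injective
    rw [hcompat ⟨y, hy⟩, map_inv, ← hk, hpin]
  have hd' := congrArg Subtype.val hd
  change 𝔉.sgpCup (𝔉.rhoYdd ⟨y, hy⟩) * (𝔉.sgpCap (𝔉.rhoYdd ⟨y, hy⟩ : Aut (𝔉.base.obj 𝔉.BN)))⁻¹ =
    ((ν (η h) : Aut 𝔉.BN))⁻¹ at hd'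
  rw [hk] at hd'
  rw [mul_one, mul_inv_cancel, inv_one, mul_one, one_mul]
  calc 𝔉.sgpCap (h : Aut (𝔉.base.obj 𝔉.BN)) * (𝔉.sgpCup h)⁻¹
      = (𝔉.sgpCup h * (𝔉.sgpCap (h : Aut (𝔉.base.obj 𝔉.BN)))⁻¹)⁻¹ := by group
    _ = (ν (η h) : Aut 𝔉.BN) := by rw [hd', inv_inv]

end Generic

/-! ### At the §5 data OF THE §1 SETTING: the pinned (iii) from the root-function clause alone -/

section AtThetaSetting

universe v₀

variable {p : ℕ} [Fact p.Prime] {D : ThetaSetting p} {E : D.EtaleThetaData} {l : ℕ} {C : E.DoubleUnderline l}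
  {e : D.toTemperedCurve.GroupLevelData} {N : ℕ+} (μ : D.CyclotomeMod l N) (hC : D.Compat) (hS : D.Sec2Hyps)
  {D₀ : Type} [Category.{v₀} D₀] {V : FrdIMonoidStub.{0}} {T₀ : RealifiedDivisorMonoids (D₀ := D₀) V}
  {VD : FrdICatStub.{1, 0, 0} (ConnectedPart (BTemp (C.temperedArithmeticGroup e).Pi))}
  {tf : TemperedFrobenioid T₀ (ConnectedPart (BTemp (C.temperedArithmeticGroup e).Pi)) VD} {hZ : tf.monoidType = MonoidType.Z}
  {hP : ∀ A : (ConnectedPart (BTemp (C.temperedArithmeticGroup e).Pi))ᵒᵖ, IsPerfect (tf.Φ.carrier A)}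
  {NH : Subgroup (Field.absoluteGaloisGroup D.K) → tf.category → ℕ+ → Prop} {A₀ : tf.category}
  {hA₀ : PreFrobenioid.IsFrobeniusTrivial tf.toElem A₀} {hA₀' : SemiGraphs.IsGaloisObj A₀.base.obj}
  {pullFrac : ∀ {A A' : (BiKummerSetting.mkOfConnectedTemperoid (C.temperedArithmeticGroup e) tf hZ hP NH A₀ hA₀ hA₀').C} (_ : A' ⟶ A),
    (BiKummerSetting.mkOfConnectedTemperoid (C.temperedArithmeticGroup e) tf hZ hP NH A₀ hA₀ hA₀').biratUnits A →
      (BiKummerSetting.mkOfConnectedTemperoid (C.temperedArithmeticGroup e) tf hZ hP NH A₀ hA₀ hA₀').biratUnits A'}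
  {θ : (BiKummerSetting.mkOfConnectedTemperoid (C.temperedArithmeticGroup e) tf hZ hP NH A₀ hA₀ hA₀').biratUnits
    (BiKummerSetting.mkOfConnectedTemperoid (C.temperedArithmeticGroup e) tf hZ hP NH A₀ hA₀ hA₀').Aodot}
  {Bl : (BiKummerSetting.mkOfConnectedTemperoid (C.temperedArithmeticGroup e) tf hZ hP NH A₀ hA₀ hA₀').C}
  {Pl : (BiKummerSetting.mkOfConnectedTemperoid (C.temperedArithmeticGroup e) tf hZ hP NH A₀ hA₀ hA₀').FractionPair θ Bl}
  {Rl : (BiKummerSetting.mkOfConnectedTemperoid (C.temperedArithmeticGroup e) tf hZ hP NH A₀ hA₀ hA₀').NthRoot θ Pl C.lPNat pullFrac}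
  (h : ModelFrobenioid.Hypotheses tf.divisorMonoid tf.ratFnFunctor)
  (Q : FrobenioidTheta.ThetaSubquotientStub.{0} (ConnectedPart (BTemp (C.temperedArithmeticGroup e).Pi)))
  (R : (BiKummerSetting.mkOfConnectedTemperoid (C.temperedArithmeticGroup e) tf hZ hP NH A₀ hA₀ hA₀').NthRoot Rl.root Rl.pair N pullFrac)
  (K' : Type) [Field K'] (constEmb : K'ˣ →* tf.biratUnitsModel R.BN) (constEmb_injective : Function.Injective constEmb)
  (hinvc : ∀ g : Aut R.AN.base,
    pull tf.divisorMonoid g.hom (ModelFrobenioid.div R.pair.num) = ModelFrobenioid.div R.pair.num)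
  (hinvp : ∀ y : (C.thetaEnvData μ hC hS).PiX, y ∈ (C.thetaEnvData μ hC hS).PiYdd →
    pull tf.divisorMonoid ((BiKummerSetting.mkOfConnectedTemperoid (C.temperedArithmeticGroup e) tf hZ hP NH A₀ hA₀ hA₀').galoisSurj
      R.AN.base R.αData.isGalois ((ContinuousMulEquiv.refl _) y)).hom (ModelFrobenioid.div R.pair.den) = ModelFrobenioid.div R.pair.den)

/-- **[EtTh] Prop. 5.2 (iii) WITH PRINT'S PIN at the §5 data of the §1 Setting, from EXACTLY the root-function clause** (the junction
«`θ := Θ̈`», GAP-LEDGER G-L2t4-2): if, for every `k ∈ Π^tp_Ÿ̲̲`, `s^⊓-gp_N(ρ k) · f_N|_{B_N} = u_{(m⁻¹(η₁ k))⁻¹} · f_N|_{B_N}` in `B(B_N^bs)`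
(«the Kummer cocycle of the Frobenioid-theoretic root of `Θ̈` under the Galois action through `s^⊓-gp_N`, read through `m`, is the mod-`N`
étale theta cocycle `η₁`»), then for every `η : H_{B_N} → (l·Δ_Θ)_{B_N} ⊗ ℤ/Nℤ` pinned to `η₁` through `m ∘ ν` the typed node
`ThetaPairKummerClass (ofThetaSettingData …) η ν` holds — «the Kummer class determined by the bi-Kummer root corresponds precisely to the
reduction modulo `N` of `η̈^Θ` relative to the natural isomorphism `ν`».  Composition of abc-iut-L2-t4's
`thetaSectionCompat_iff_rootKummer_ofThetaSettingData` (←) with `thetaPairKummerClass_of_thetaSectionCompat_envData`.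
[cite: MochizukiEtTh2009, Prop 5.2 (iii) p.324 (PDF p.98)] -/
theorem thetaPairKummerClass_ofThetaSettingData_of_rootKummer
    (H : (ofThetaSettingData μ hC hS h Q R K' constEmb constEmb_injective hinvc hinvp).Facts)
    (m : (ofThetaSettingData μ hC hS h Q R K' constEmb constEmb_injective hinvc hinvp).muTorsion
      (ofThetaSettingData μ hC hS h Q R K' constEmb constEmb_injective hinvc hinvp).BN N ≃* (C.thetaEnvData μ hC hS).mu)
    (η₁ : (C.thetaEnvData μ hC hS).PiYdd → (C.thetaEnvData μ hC hS).mu)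
    (hroot : ∀ k : (C.thetaEnvData μ hC hS).PiYdd,
        ((tf.biratAutModel R.BN
            ((ofThetaSettingData μ hC hS h Q R K' constEmb constEmb_injective hinvc hinvp).sgpCap
              ((ofThetaSettingData μ hC hS h Q R K' constEmb constEmb_injective hinvc hinvp).ρ k.1))
            (tf.restrictAlongModel R.pair.num R.pair.isPreStep_num R.root) : tf.biratUnitsModel R.BN) :
            tf.ratFnFunctor.obj (op R.BN.base)) =
          (ModelFrobenioid.unit
              (((m.symm (η₁ k))⁻¹ : (ofThetaSettingData μ hC hS h Q R K' constEmb constEmb_injective hinvc hinvp).muTorsion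
                (ofThetaSettingData μ hC hS h Q R K' constEmb constEmb_injective hinvc hinvp).BN N).1.hom) : tf.ratFnFunctor.obj (op R.BN.base)) *
            ((tf.restrictAlongModel R.pair.num R.pair.isPreStep_num R.root : tf.biratUnitsModel R.BN) : tf.ratFnFunctor.obj (op R.BN.base)))
    (ν : (ofThetaSettingData μ hC hS h Q R K' constEmb constEmb_injective hinvc hinvp).lDeltaModN
        (ofThetaSettingData μ hC hS h Q R K' constEmb constEmb_injective hinvc hinvp).BN ≃*
      (ofThetaSettingData μ hC hS h Q R K' constEmb constEmb_injective hinvc hinvp).muTorsion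
        (ofThetaSettingData μ hC hS h Q R K' constEmb constEmb_injective hinvc hinvp).BN N)
    (η : (ofThetaSettingData μ hC hS h Q R K' constEmb constEmb_injective hinvc hinvp).HB →
      (ofThetaSettingData μ hC hS h Q R K' constEmb constEmb_injective hinvc hinvp).lDeltaModN
        (ofThetaSettingData μ hC hS h Q R K' constEmb constEmb_injective hinvc hinvp).BN)
    (hpin : ∀ k : (ofThetaSettingData μ hC hS h Q R K' constEmb constEmb_injective hinvc hinvp).PiYdd,
      m (ν (η ((ofThetaSettingData μ hC hS h Q R K' constEmb constEmb_injective hinvc hinvp).rhoYdd k))) =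
        η₁ ⟨(ContinuousMulEquiv.refl _).toMulEquiv k.1,
          (identifiesPiYdd_ofThetaSettingData' μ hC hS h Q R K' constEmb constEmb_injective hinvc hinvp k).mp k.2⟩) :
    FrobenioidThetaBiKummer.ThetaPairKummerClass (ofThetaSettingData μ hC hS h Q R K' constEmb constEmb_injective hinvc hinvp) η ν :=
  thetaPairKummerClass_of_thetaSectionCompat_envData _ (C.thetaEnvData μ hC hS) H (ContinuousMulEquiv.refl _).toMulEquiv m
    (identifiesPiYdd_ofThetaSettingData' μ hC hS h Q R K' constEmb constEmb_injective hinvc hinvp)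
    ((thetaSectionCompat_iff_rootKummer_ofThetaSettingData μ hC hS h Q R K' constEmb constEmb_injective hinvc hinvp H m η₁).mpr hroot)
    ν η hpin

end AtThetaSetting

end ThetaFrobenioid

end Literature.AnabelianGeometry.EtaleTheta

end
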